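import Literature.NumberTheory.EllipticCurves.FormalGroupShortModelParityProofs
import Literature.NumberTheory.EllipticCurves.FormalGroupHasseInvariantProofs
import Literature.NumberTheory.EllipticCurves.FormalGroupXDerivativeProofs
import Mathlib.RingTheory.AdicCompletion.Basic
import Mathlib.RingTheory.Jacobson.Ideal
import Mathlib.Algebra.CharP.Quotient
import Mathlib.NumberTheory.Padics.RingHoms
import HarnessLib

/-!
# The `p`-adic Weierstrass zeta function of an ordinary Weierstrass model
# (Blakestad–Grant 2023, Theorem 2 with Prop. 3 and Lemma 4) — proofs only

Trunk T-NT-EC (Literature/NumberTheory/EllipticCurves). For a Weierstrass model with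
`a₁ = a₃ = 0` (`y² = x³ + a₂x² + a₄x + a₆`, Mathlib `IsCharNeTwoNF`; Blakestad–Grant take
`a₂ = 0`) over a ring `R`, parameter `z = -x/y` at `O`, `X = z²x(z)` (`formalXMulSq`),
`ω = W(z)dz`, `W = Σ wₙ zⁿ = formalInvDiff`, `η = W⁻¹ = formalEta`, `D = d/ω = η·d/dz`
(`formalInvariantDerivation`), we prove the existence of the **`p`-adic Weierstrass zeta
function**: if `R` is `p`-adically complete and separated, additively torsion-free, and the Hasse
coefficients `w_{pⁿ-1}` are units (ordinary reduction; for this it suffices that `w_{p-1} ≡`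
Hasse invariant be a unit, `isUnit_coeff_formalInvDiff_prime_pow_sub_one`), then there are a
unique constant `β ∈ R` and a series `Λ = 1 + ⋯ ∈ R⟦z⟧` with

  `η · (z Λ' - Λ) = -(X - β z²)`,  i.e.  `D ζ = -x + β` for the odd Laurent series `ζ := Λ/z ∈ 1/z + R⟦z⟧`

(Blakestad–Grant, Thm. 2: "there is a unique Laurent series `ζ` in `1/t + R̂⟦t⟧` … such that
`D(ζ) + x(t)` is some element `β ∈ R̂`"); equivalently, the differential of the second kind
`(x - β)ω` is formally exact over `R`: `k ∣ [z^{k+1}]((X - βz²)W)` for every `k`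
(`exists_padicWeierstrassZetaConst`, `exists_padicWeierstrassZetaSeries`,
`padicWeierstrassZetaConst_unique` for the uniqueness of `β`; over `ℤ_p`:
`padicInt_exists_padicWeierstrassZeta`). This is the first half of Blakestad–Grant's
construction of the Mazur–Tate `p`-adic sigma function (`σ = z·exp ∫(ζ - Dz/z)ω`, their Thm. 1, the existence half
of the tree's named fact `WeierstrassCurve.mazur_tate_sigma_existsUnique`, Mazur–Stein–Tate 2006
Thm. 1.3): `ζ = Dσ/σ` and `β = -c` for a Mazur–Tate pair `(σ, c)`.

## The proof (Blakestad–Grant §2.1, made elementary)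

Everything is formal Laurent-series algebra with poles cleared by powers of `z`. Fix an odd
`K = 2B + 3` (later `K = pⁿ`).
* (Prop. 3(a)) `exists_zFun`: an `R`-combination `Z = Σ_b c_b z^{2(B-b)} X^{b+1}` of the cleared
  expansions `z^K · (-y x^b) = z^{2(B-b)}X^{b+1}` of the odd functions `y x^b` (`z³y = -X`), with
  `Z = 1 + O(z^{K-1})` — i.e. `z_K := Z/z^K ∈ L(K·O)` has principal part `z^{-K} + h z^{-1}`
  (triangular elimination; the odd coefficients vanish by parity, `a₁ = a₃ = 0`).
* (Lemma 4, the residue) `coeff_formalXMulSq_pow_mul_formalInvDiff`: `res(y x^b ω) = 0`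
  (`y x^b ω = x^b dx/2 = d(x^{b+1})/(2b+2)`), whence `h = -w_{K-1}`.
* (Prop. 3(c)) `X_mul_D_sub_eq_of_zMonomial`: `D` maps `y x^b` to the polynomial
  `(2b+3)x^{b+2} + 2(b+1)a₂x^{b+1} + (2b+1)a₄x^b + 2b a₆ x^{b-1}` (`Dx = 2y`, `Dy = f'(x)`), in
  cleared form `Λ_K(z^{2i}X^{b+1}) ∈ span{z^{2j}X^{B+2-j}}` for `Λ_K(F) := z·DF - Kη F`
  (`Λ_K(z^K g) = z^{K+1} Dg`); modulo `K` one has `Λ_K(Z) ≡ zηZ'`, which vanishes below degree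
  `K - 1`, so by unitriangularity (`mem_of_coeff_sum_mem`) `Λ_K(Z) ≡ -z^{K-1}(hX + r z²)`,
  i.e. **`z_K' ≡ (w_{K-1} x - r) W (mod K)`**: the differential `(w_{K-1}x - r)ω` is exact
  modulo `K` (`padicWeierstrassZeta_core`, over a ring in which `K = 0`;
  `padicWeierstrassZeta_level` over `R`).
* (Thm. 2) With `β_n = r/w_{pⁿ-1}` for `K = pⁿ`: `β_{n+1} ≡ β_n (mod pⁿ)` (compare the
  `z^{pⁿ+1}`-coefficients — Lemma 4), `β = lim β_n` (`IsPrecomplete`), and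
  `[z^{k+1}]((X - βz²)W) ∈ kR + pⁿR` for all `n`, `= kR` since integers prime to `p` are units of
  the `p`-adically complete ring `R`; uniqueness of `β` by `IsHausdorff`.

## Sources

* C. Blakestad, D. Grant, *On the universal `p`-adic sigma and Weierstrass zeta functions*,
  J. Number Theory 249 (2023) 348–376 (arXiv:1903.02480), §2.1: Thm. 2, Prop. 3 (a)(b)(c),
  Lemma 4 and the proof of Thm. 2 (held copy `paper:arxiv-1903.02480`, chunks 5–6).
  [BlakestadGrant2023]
* B. Mazur, J. Tate, *The `p`-adic sigma function*, Duke Math. J. 62 (1991) §3 (`ζ = Dσ/σ`);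
  B. Mazur, W. Stein, J. Tate, Doc. Math. Extra Vol. Coates (2006), Thm. 1.3 and §3.1
  (`x + c = -D(Dσ/σ)`). [MazurSteinTate2006]
* J. F. Voloch, Acta Arith. 79 (1997) 1–6 (the characteristic-`p` analogue, as cited by
  Blakestad–Grant for the method).

## Design notes

Pure proof file: no definitions, no named facts. The ring of definition is arbitrary
(`IsAddTorsionFree` is used for the parity/residue cancellations `2m·a = 0 ⇒ a = 0`; it holds for
`ℤ_p` and for Blakestad–Grant's `p`-torsion-free `ℤ_(p)`-algebra `R̂`), so the results apply both
to a single ordinary curve over `ℤ_p` and to families. "Modulo `K`" is handled by base change to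
`R ⧸ (K)` (`padicWeierstrassZeta_core` is stated over a ring in which `K = 0`).
-/

noncomputable section

open PowerSeries Literature.NumberTheory.EllipticCurves

namespace Literature.NumberTheory.EllipticCurves

/-! ### Generic power-series lemmas -/

section Generic

variable {R : Type*} [CommRing R]

/-- `[zⁿ](z^k · f) = [z^{n-k}] f` for `k ≤ n`. [folklore] -/
theorem coeff_X_pow_mul_of_le {k n : ℕ} (h : k ≤ n) (f : R⟦X⟧) :
    coeff n (X ^ k * f) = coeff (n - k) f := by
  rw [coeff_X_pow_mul', if_pos h]

/-- `[zⁿ](z^k · f) = 0` for `n < k`. [folklore] -/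
theorem coeff_X_pow_mul_of_lt {k n : ℕ} (h : n < k) (f : R⟦X⟧) :
    coeff n (X ^ k * f) = 0 := by
  rw [coeff_X_pow_mul', if_neg (not_le.mpr h)]

/-- `z ↦ -z` fixes `z^{2i}`. [folklore] -/
theorem rescale_neg_one_X_pow_two_mul (i : ℕ) :
    rescale (-1 : R) ((X : R⟦X⟧) ^ (2 * i)) = X ^ (2 * i) := by
  rw [map_pow, rescale_X, mul_pow, ← map_pow, pow_mul, neg_one_sq, one_pow, map_one, one_mul]

/-- `rescale` fixes constants. [folklore] -/
theorem rescale_C_eq (a r : R) : rescale a (C r : R⟦X⟧) = C r := by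
  ext n
  rcases n with _ | n <;> simp [coeff_rescale, coeff_C]

/-- **Unitriangularity.** For series `U_j` with constant term `1` and scalars `r_j`, if the
coefficients of `z^{2j}`, `j < j₀`, of `Σ_{j ≤ N} r_j z^{2j} U_j` lie in an ideal `I`, then so do
the `r_j`, `j < j₀`. [folklore] -/
theorem mem_of_coeff_sum_mem (I : Ideal R) (U : ℕ → R⟦X⟧) (hU : ∀ j, constantCoeff (U j) = 1)
    (r : ℕ → R) (N j₀ : ℕ) (hj₀ : j₀ ≤ N + 1)
    (h : ∀ j < j₀, coeff (2 * j)
      (∑ i ∈ Finset.range (N + 1), C (r i) * (X ^ (2 * i) * U i)) ∈ I) :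
    ∀ j < j₀, r j ∈ I := by
  intro j
  induction j using Nat.strong_induction_on with
  | _ j ih =>
    intro hj
    have hjN : j ∈ Finset.range (N + 1) := Finset.mem_range.mpr (by omega)
    have hsplit := h j hj
    rw [map_sum, ← Finset.add_sum_erase _ _ hjN] at hsplit
    have hdiag : coeff (2 * j) (C (r j) * (X ^ (2 * j) * U j)) = r j := by
      rw [coeff_C_mul, coeff_X_pow_mul_of_le le_rfl, Nat.sub_self, coeff_zero_eq_constantCoeff,
        hU, mul_one]
    have hrest : ∑ i ∈ (Finset.range (N + 1)).erase j, coeff (2 * j) (C (r i) * (X ^ (2 * i) * U i))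
        ∈ I := by
      refine I.sum_mem fun i hi => ?_
      rcases Finset.mem_erase.mp hi with ⟨hij, -⟩
      rw [coeff_C_mul]
      rcases lt_or_gt_of_ne hij with hlt | hgt
      · exact I.mul_mem_right _ (ih i hlt (lt_trans hlt hj))
      · rw [coeff_X_pow_mul_of_lt (by omega), mul_zero]
        exact I.zero_mem
    rw [hdiag] at hsplit
    have := I.sub_mem hsplit hrest
    rwa [add_sub_cancel_right] at this

/-- A unit modulo an ideal contained in the Jacobson radical is a unit. [folklore] -/
theorem isUnit_of_isUnit_quotient_mk {I : Ideal R} (hI : I ≤ (⊥ : Ideal R).jacobson) {x : R}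
    (hx : IsUnit (Ideal.Quotient.mk I x)) : IsUnit x := by
  obtain ⟨y, hy⟩ := hx.exists_right_inv
  obtain ⟨y, rfl⟩ := Ideal.Quotient.mk_surjective y
  rw [← map_mul, ← map_one (Ideal.Quotient.mk I), Ideal.Quotient.eq] at hy
  have h1 : IsUnit (x * y) := by
    have h := Ideal.mem_jacobson_bot.mp (hI hy) 1
    rwa [mul_one, sub_add_cancel] at h
  exact isUnit_of_mul_isUnit_left h1

/-- In a `p`-adically complete ring an integer prime to `p` is a unit. [folklore] -/
theorem isUnit_natCast_of_coprime {p : ℕ} [IsAdicComplete (Ideal.span {(p : R)}) R] {m : ℕ}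
    (hm : Nat.Coprime m p) : IsUnit (m : R) := by
  have hJ : Ideal.span {(p : R)} ≤ (⊥ : Ideal R).jacobson := IsAdicComplete.le_jacobson_bot _
  obtain ⟨a, b, hab⟩ := (Nat.isCoprime_iff_coprime.mpr hm : IsCoprime (m : ℤ) (p : ℤ))
  have habR : (a : R) * m + b * p = 1 := by exact_mod_cast congrArg (Int.cast : ℤ → R) hab
  have hu : IsUnit ((a : R) * m) := by
    have h := Ideal.mem_jacobson_bot.mp (hJ (Ideal.mem_span_singleton_self _)) (-(b : R))
    rw [show (p : R) * -(b : R) + 1 = (a : R) * m by linear_combination -habR] at h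
    exact h
  exact isUnit_of_mul_isUnit_right hu

end Generic

end Literature.NumberTheory.EllipticCurves

namespace WeierstrassCurve

variable {R : Type*} [CommRing R] (W : WeierstrassCurve R)

/-! ### The basic identities for `a₁ = a₃ = 0` -/

section Identities

variable [W.IsCharNeTwoNF]

/-- **`Dx = 2y`**, cleared: `z · D(X) = 2ηX - 2X` (`X = z²x`, `z³y = -X`, `a₁ = a₃ = 0`).
[Blakestad–Grant 2023, §2 ("the unique derivation such that `Dx = 2y`")] [folklore] -/
theorem X_mul_formalInvariantDerivation_formalXMulSq_of_isCharNeTwoNF :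
    X * W.formalInvariantDerivation W.formalXMulSq =
      2 * W.formalEta * W.formalXMulSq - 2 * W.formalXMulSq := by
  rw [W.X_mul_formalInvariantDerivation_formalXMulSq, W.a₁_of_isCharNeTwoNF,
    W.a₃_of_isCharNeTwoNF, map_zero, zero_mul, zero_mul, zero_sub, add_zero]
  ring

/-- **`η·X = 3X² - 2X + 2a₂z²X + a₄z⁴`** for `a₁ = a₃ = 0`. [folklore] -/
theorem formalEta_mul_formalXMulSq_of_isCharNeTwoNF :
    W.formalEta * W.formalXMulSq = 3 * W.formalXMulSq ^ 2 - 2 * W.formalXMulSq +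
      2 * C W.a₂ * X ^ 2 * W.formalXMulSq + C W.a₄ * X ^ 4 := by
  have h := W.formalEta_mul_formalXMulSq
  rw [W.a₁_of_isCharNeTwoNF, W.a₃_of_isCharNeTwoNF, map_zero] at h
  linear_combination h

/-- **The Weierstrass equation `y² = x³ + a₂x² + a₄x + a₆`, cleared by `z⁶`**:
`X² = X³ + a₂z²X² + a₄z⁴X + a₆z⁶`. [folklore] -/
theorem formalXMulSq_sq_eq_of_isCharNeTwoNF :
    W.formalXMulSq ^ 2 = W.formalXMulSq ^ 3 + C W.a₂ * X ^ 2 * W.formalXMulSq ^ 2 +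
      C W.a₄ * X ^ 4 * W.formalXMulSq + C W.a₆ * X ^ 6 := by
  have h := W.formalXMulSq_sq_eq
  rw [W.a₁_of_isCharNeTwoNF, W.a₃_of_isCharNeTwoNF, map_zero] at h
  linear_combination h

/-- **`ω = dx/2y`**, cleared: `2·W·X = 2X - z X'` (`W = ω/dz`). [Blakestad–Grant 2023, §2
(`ω = dx/2y`)] [folklore] -/
theorem two_mul_formalInvDiff_mul_formalXMulSq :
    2 * W.formalInvDiff * W.formalXMulSq = 2 * W.formalXMulSq - X * d⁄dX R W.formalXMulSq := by
  have h := W.X_mul_formalInvariantDerivation_formalXMulSq_of_isCharNeTwoNF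
  rw [formalInvariantDerivation_apply] at h
  have hωη := W.formalInvDiff_mul_formalEta
  linear_combination W.formalInvDiff * h + (2 * W.formalXMulSq - X * d⁄dX R W.formalXMulSq) * hωη

/-- `X = z²x` is even, hence so are the cleared monomials `z^{2i} X^m`. [folklore] -/
theorem rescale_neg_one_X_pow_mul_formalXMulSq_pow (i m : ℕ) :
    rescale (-1 : R) (X ^ (2 * i) * W.formalXMulSq ^ m) = X ^ (2 * i) * W.formalXMulSq ^ m := by
  rw [map_mul, map_pow (rescale (-1 : R)) W.formalXMulSq, W.rescale_neg_one_formalXMulSq,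
    rescale_neg_one_X_pow_two_mul]

/-- `W = ω/dz` is even (`a₁ = a₃ = 0`). [Blakestad–Grant 2023, proof of Prop. 3(c) ("there is no
quadratic term in the expansion of `ω`")] [folklore] -/
theorem rescale_neg_one_formalInvDiff : rescale (-1 : R) W.formalInvDiff = W.formalInvDiff := by
  have h1 := congrArg (rescale (-1 : R)) W.formalInvDiff_mul_formalEta
  rw [map_mul, map_one, W.rescale_neg_one_formalEta] at h1
  calc rescale (-1 : R) W.formalInvDiff
      = rescale (-1 : R) W.formalInvDiff * (W.formalEta * W.formalInvDiff) := by
        rw [W.formalEta_mul_formalInvDiff, mul_one]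
    _ = W.formalInvDiff := by rw [← mul_assoc, h1, one_mul]

/-- **The residue of `y x^b ω` vanishes** (Lemma 4: "the sum of the residues of `z_n ω` is `0`";
here directly: `y x^b ω = x^b dx/2 = d(x^{b+1})/(2b+2)`), cleared: `[z^{2b+2}](X^{b+1}·W) = 0`.
[Blakestad–Grant 2023, Lemma 4 (proof)] [cite: BlakestadGrant2023, Lemma 4] -/
theorem coeff_formalXMulSq_pow_mul_formalInvDiff [IsAddTorsionFree R] (b : ℕ) :
    coeff (2 * b + 2) (W.formalXMulSq ^ (b + 1) * W.formalInvDiff) = 0 := by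
  set Xs := W.formalXMulSq
  -- `2(b+1)·X^{b+1}·W = 2(b+1)X^{b+1} - z (X^{b+1})'`
  have hkey : (2 * ((b : R⟦X⟧) + 1)) * (Xs ^ (b + 1) * W.formalInvDiff) =
      (2 * ((b : R⟦X⟧) + 1)) * Xs ^ (b + 1) - X * d⁄dX R (Xs ^ (b + 1)) := by
    have h2 := W.two_mul_formalInvDiff_mul_formalXMulSq
    rw [Derivation.leibniz_pow, Nat.add_sub_cancel, smul_eq_mul, nsmul_eq_mul]
    push_cast
    linear_combination ((b : R⟦X⟧) + 1) * Xs ^ b * h2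
  have hc := congrArg (coeff (2 * b + 2)) hkey
  rw [show (2 * ((b : R⟦X⟧) + 1)) = C (2 * ((b : R) + 1)) by
      rw [map_mul, map_add, map_natCast, map_one, map_ofNat], coeff_C_mul, map_sub,
    coeff_C_mul, show 2 * b + 2 = (2 * b + 1) + 1 from rfl, coeff_succ_X_mul,
    coeff_derivative] at hc
  have h0 : (2 * ((b : R) + 1)) * coeff (2 * b + 1 + 1) (Xs ^ (b + 1) * W.formalInvDiff) = 0 := by
    rw [hc]; push_cast; ring
  have hn : (2 * (b + 1)) • coeff (2 * b + 1 + 1) (Xs ^ (b + 1) * W.formalInvDiff) = 0 := by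
    rw [nsmul_eq_mul]; push_cast; exact h0
  exact (nsmul_eq_zero_iff.mp hn).resolve_right (by omega)

/-! ### `D` on the odd monomials `y x^b` (Prop. 3(c)) -/

omit [W.IsCharNeTwoNF] in
/-- `z · D(zⁿ) = n η zⁿ`. [folklore] -/
theorem X_mul_formalInvariantDerivation_X_pow (n : ℕ) :
    X * W.formalInvariantDerivation (X ^ n) = (n : R⟦X⟧) * W.formalEta * X ^ n := by
  rcases n with _ | n
  · simp
  · rw [Derivation.leibniz_pow, Nat.add_sub_cancel, formalInvariantDerivation_X, smul_eq_mul,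
      nsmul_eq_mul, pow_succ]
    push_cast
    ring

/-- **`D(y x^b) = (2b+3)x^{b+2} + 2(b+1)a₂x^{b+1} + (2b+1)a₄x^b + 2b a₆x^{b-1}`** (`Dx = 2y`,
`Dy = 3x² + 2a₂x + a₄`), in cleared form: for `K = 2(b+i) + 3` and `G = z^{2i}X^{b+1} = z^K·(-yx^b)`,
`Λ_K(G) := z·DG - KηG` (`= z^{K+1}·D(G/z^K)`) equals
`-( (2b+3) z^{2i}X^{b+2} + 2(b+1)a₂ z^{2i+2}X^{b+1} + (2b+1)a₄ z^{2i+4}X^b + 2ba₆ z^{2i+6}X^{b-1} )`.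
[Blakestad–Grant 2023, Prop. 3(c) (proof: "`Dz_n` … is of the form `a_n x + b_n` mod `pⁿ`")]
[folklore] -/
theorem X_mul_D_sub_eq_of_zMonomial (b i : ℕ) :
    X * W.formalInvariantDerivation (X ^ (2 * i) * W.formalXMulSq ^ (b + 1)) -
        C ((2 * (b + i) + 3 : ℕ) : R) * W.formalEta * (X ^ (2 * i) * W.formalXMulSq ^ (b + 1)) =
      -(C ((2 * b + 3 : ℕ) : R) * (X ^ (2 * i) * W.formalXMulSq ^ (b + 2)) +
        C (2 * ((b : R) + 1) * W.a₂) * (X ^ (2 * (i + 1)) * W.formalXMulSq ^ (b + 1)) +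
        C ((2 * (b : R) + 1) * W.a₄) * (X ^ (2 * (i + 2)) * W.formalXMulSq ^ b) +
        C (2 * (b : R) * W.a₆) * (X ^ (2 * (i + 3)) * W.formalXMulSq ^ (b - 1))) := by
  set Xs := W.formalXMulSq with hXs
  set η := W.formalEta with hη
  have hE1 := W.X_mul_formalInvariantDerivation_formalXMulSq_of_isCharNeTwoNF
  have hE2 := W.formalEta_mul_formalXMulSq_of_isCharNeTwoNF
  have hE3 := W.formalXMulSq_sq_eq_of_isCharNeTwoNF
  have hXp := W.X_mul_formalInvariantDerivation_X_pow (2 * i)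
  -- `z·D(z^{2i} X^{b+1}) = 2i η G + (b+1) z^{2i} X^b (z·DX)`
  have hD : X * W.formalInvariantDerivation (X ^ (2 * i) * Xs ^ (b + 1)) =
      ((2 * i : ℕ) : R⟦X⟧) * η * (X ^ (2 * i) * Xs ^ (b + 1)) +
        ((b : R⟦X⟧) + 1) * X ^ (2 * i) * Xs ^ b * (2 * η * Xs - 2 * Xs) := by
    rw [Derivation.leibniz, Derivation.leibniz_pow, Nat.add_sub_cancel, smul_eq_mul, smul_eq_mul,
      nsmul_eq_mul]
    push_cast at hXp ⊢
    linear_combination Xs ^ (b + 1) * hXp + ((b : R⟦X⟧) + 1) * X ^ (2 * i) * Xs ^ b * hE1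
  rw [hD]
  simp only [map_mul, map_add, map_natCast, map_ofNat, map_one, Nat.cast_add, Nat.cast_mul,
    Nat.cast_ofNat]
  rcases b with _ | b
  · simp only [Nat.cast_zero, zero_add, mul_zero, zero_mul, add_zero, pow_one, pow_zero, mul_one]
    linear_combination (-(X ^ (2 * i))) * hE2
  · simp only [Nat.cast_succ, Nat.add_sub_cancel]
    linear_combination (-(X ^ (2 * i) * Xs ^ (b + 1))) * hE2 -
      (2 * ((b : R⟦X⟧) + 1)) * X ^ (2 * i) * Xs ^ b * hE3

end Identities

/-! ### The function `z_K ∈ L(K·O)` (Prop. 3(a)), cleared: `Z = z^K z_K` -/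

section ZFun

variable [W.IsCharNeTwoNF]

omit [W.IsCharNeTwoNF] in
/-- **Prop. 3(a), cleared by `z^K` (`K = 2B+3`)**: there is an `R`-combination
`Z = Σ_{b ≤ B} c_b z^{2(B-b)} X^{b+1}` of the cleared odd monomials `z^K·(-yx^b)` with constant
term `1` and vanishing coefficients of `z², z⁴, …, z^{2i}` (`i ≤ B`) — triangular elimination
("the existence of such a `z_n` comes from (2) using induction"). [Blakestad–Grant 2023,
Prop. 3(a)] [cite: BlakestadGrant2023, Prop. 3] -/
theorem exists_zFun_aux (B i : ℕ) (hi : i ≤ B) :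
    ∃ Z : R⟦X⟧, (∃ c : ℕ → R, Z = ∑ b ∈ Finset.range (B + 1),
        C (c b) * (X ^ (2 * (B - b)) * W.formalXMulSq ^ (b + 1))) ∧
      constantCoeff Z = 1 ∧ ∀ j, 1 ≤ j → j ≤ i → coeff (2 * j) Z = 0 := by
  induction i with
  | zero =>
    refine ⟨W.formalXMulSq ^ (B + 1), ⟨fun b => if b = B then 1 else 0, ?_⟩, ?_, ?_⟩
    · rw [Finset.sum_eq_single_of_mem B (Finset.mem_range.mpr B.lt_succ_self)]
      · simp
      · intro b _ hb
        simp [hb]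
    · rw [map_pow, constantCoeff_formalXMulSq, one_pow]
    · intro j hj1 hj0; omega
  | succ i ih =>
    obtain ⟨Z, ⟨c, hc⟩, h0, hcoeff⟩ := ih (Nat.le_of_succ_le hi)
    set a := coeff (2 * (i + 1)) Z with ha
    refine ⟨Z - C a * (X ^ (2 * (i + 1)) * W.formalXMulSq ^ (B - i)),
      ⟨fun b => if b = B - (i + 1) then c b - a else c b, ?_⟩, ?_, ?_⟩
    · have hmem : B - (i + 1) ∈ Finset.range (B + 1) := Finset.mem_range.mpr (by omega)
      beta_reduce
      rw [hc, ← Finset.add_sum_erase _ _ hmem, ← Finset.add_sum_erase _ _ hmem, if_pos rfl]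
      have hrest : ∑ b ∈ (Finset.range (B + 1)).erase (B - (i + 1)),
          C (if b = B - (i + 1) then c b - a else c b) * (X ^ (2 * (B - b)) * W.formalXMulSq ^ (b + 1)) =
          ∑ b ∈ (Finset.range (B + 1)).erase (B - (i + 1)),
            C (c b) * (X ^ (2 * (B - b)) * W.formalXMulSq ^ (b + 1)) := by
        refine Finset.sum_congr rfl fun b hb => ?_
        rw [if_neg (Finset.mem_erase.mp hb).1]
      rw [hrest, show B - (B - (i + 1)) = i + 1 by omega, show B - (i + 1) + 1 = B - i by omega,
        map_sub]
      ring
    · rw [map_sub, h0, map_mul, map_mul, map_pow, constantCoeff_X, zero_pow (by omega), zero_mul,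
        mul_zero, sub_zero]
    · intro j hj1 hj2
      rw [map_sub, coeff_C_mul]
      rcases Nat.lt_or_ge j (i + 1) with hlt | hge
      · rw [hcoeff j hj1 (by omega), coeff_X_pow_mul_of_lt (by omega), mul_zero, sub_zero]
      · have hj : j = i + 1 := le_antisymm hj2 hge
        subst hj
        rw [coeff_X_pow_mul_of_le le_rfl, Nat.sub_self, coeff_zero_eq_constantCoeff, map_pow,
          constantCoeff_formalXMulSq, one_pow, mul_one, ← ha, sub_self]

/-- **`Z = z^K z_K = 1 + O(z^{K-1})`** (`K = 2B+3`): the combination of `exists_zFun_aux` has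
constant term `1` and NO terms of degree `1, …, K-2 = 2B+1` — the odd ones vanish because `Z` is
even (`a₁ = a₃ = 0`, torsion-free coefficients; "its uniqueness makes `z_n` odd") — and it
satisfies the residue relation `[z^{K-1}](Z·W) = 0`, i.e. `res(z_K ω) = 0` (Lemma 4), which says
`[z^{K-1}]Z = -w_{K-1}`. [Blakestad–Grant 2023, Prop. 3(a), Lemma 4]
[cite: BlakestadGrant2023, Prop. 3] -/
theorem exists_zFun [IsAddTorsionFree R] (B : ℕ) :
    ∃ Z : R⟦X⟧, (∃ c : ℕ → R, Z = ∑ b ∈ Finset.range (B + 1),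
        C (c b) * (X ^ (2 * (B - b)) * W.formalXMulSq ^ (b + 1))) ∧
      constantCoeff Z = 1 ∧ (∀ j, 1 ≤ j → j ≤ 2 * B + 1 → coeff j Z = 0) ∧
      coeff (2 * B + 2) (Z * W.formalInvDiff) = 0 := by
  obtain ⟨Z, ⟨c, hc⟩, h0, hcoeff⟩ := W.exists_zFun_aux B B le_rfl
  refine ⟨Z, ⟨c, hc⟩, h0, ?_, ?_⟩
  · intro j hj1 hj2
    rcases Nat.even_or_odd j with ⟨m, rfl⟩ | hodd
    · rw [← two_mul]; exact hcoeff m (by omega) (by omega)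
    · refine coeff_eq_zero_of_rescale_neg_one_eq_self ?_ hodd
      rw [hc, map_sum]
      refine Finset.sum_congr rfl fun b _ => ?_
      rw [map_mul, rescale_C_eq, W.rescale_neg_one_X_pow_mul_formalXMulSq_pow]
  · rw [hc, Finset.sum_mul, map_sum]
    refine Finset.sum_eq_zero fun b hb => ?_
    have hbB : b ≤ B := Nat.lt_succ_iff.mp (Finset.mem_range.mp hb)
    rw [mul_assoc, coeff_C_mul, mul_assoc, coeff_X_pow_mul_of_le (by omega),
      show 2 * B + 2 - 2 * (B - b) = 2 * b + 2 by omega,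
      W.coeff_formalXMulSq_pow_mul_formalInvDiff, mul_zero]

end ZFun

/-! ### The core congruence (Prop. 3(c) with Lemma 4), over a ring in which `K = 0` -/

section Core

variable [W.IsCharNeTwoNF]

/-- `Λ_K` of each cleared odd monomial lies in the span of the cleared even monomials
`z^{2j} X^{B+2-j}`, `j ≤ B + 2`. [Blakestad–Grant 2023, Prop. 3(c) (proof)] [folklore] -/
theorem exists_X_mul_D_sub_zMonomial_eq_sum {B b : ℕ} (hb : b ≤ B) (a : R) :
    ∃ r : ℕ → R,
      X * W.formalInvariantDerivation (C a * (X ^ (2 * (B - b)) * W.formalXMulSq ^ (b + 1))) -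
          C ((2 * B + 3 : ℕ) : R) * W.formalEta * (C a * (X ^ (2 * (B - b)) * W.formalXMulSq ^ (b + 1))) =
        ∑ j ∈ Finset.range (B + 3), C (r j) * (X ^ (2 * j) * W.formalXMulSq ^ (B + 2 - j)) := by
  set i := B - b with hi
  have hK : 2 * B + 3 = 2 * (b + i) + 3 := by omega
  have hlin : X * W.formalInvariantDerivation (C a * (X ^ (2 * i) * W.formalXMulSq ^ (b + 1))) -
      C ((2 * B + 3 : ℕ) : R) * W.formalEta * (C a * (X ^ (2 * i) * W.formalXMulSq ^ (b + 1))) =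
      C a * (X * W.formalInvariantDerivation (X ^ (2 * i) * W.formalXMulSq ^ (b + 1)) -
        C ((2 * (b + i) + 3 : ℕ) : R) * W.formalEta * (X ^ (2 * i) * W.formalXMulSq ^ (b + 1))) := by
    rw [Derivation.leibniz, formalInvariantDerivation_C, smul_zero, add_zero, smul_eq_mul, hK]
    ring
  rw [hlin, W.X_mul_D_sub_eq_of_zMonomial b i]
  -- the four target monomials are `z^{2j} X^{B+2-j}` for `j = i, i+1, i+2, i+3`
  -- (the last one only occurs with coefficient `2b·a₆`, which vanishes when `b = 0`, `i+3 > B+2`)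
  rcases Nat.eq_zero_or_pos b with rfl | hbpos
  · refine ⟨fun j => if j = i then -(a * (3 : ℕ)) else if j = i + 1 then -(a * (2 * (0 + 1) * W.a₂))
      else if j = i + 2 then -(a * ((2 * 0 + 1) * W.a₄)) else 0, ?_⟩
    have hsum : ∀ (f : ℕ → R⟦X⟧), ∑ j ∈ Finset.range (B + 3),
        C (if j = i then -(a * (3 : ℕ)) else if j = i + 1 then -(a * (2 * (0 + 1) * W.a₂))
          else if j = i + 2 then -(a * ((2 * 0 + 1) * W.a₄)) else 0) * f j =
        C (-(a * (3 : ℕ))) * f i + C (-(a * (2 * (0 + 1) * W.a₂))) * f (i + 1) +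
          C (-(a * ((2 * 0 + 1) * W.a₄))) * f (i + 2) := by
      intro f
      have hi0 : i ∈ Finset.range (B + 3) := Finset.mem_range.mpr (by omega)
      have hi1 : i + 1 ∈ (Finset.range (B + 3)).erase i :=
        Finset.mem_erase.mpr ⟨by omega, Finset.mem_range.mpr (by omega)⟩
      have hi2 : i + 2 ∈ ((Finset.range (B + 3)).erase i).erase (i + 1) :=
        Finset.mem_erase.mpr ⟨by omega, Finset.mem_erase.mpr ⟨by omega, Finset.mem_range.mpr (by omega)⟩⟩
      rw [← Finset.add_sum_erase _ _ hi0, ← Finset.add_sum_erase _ _ hi1,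
        ← Finset.add_sum_erase _ _ hi2, if_pos rfl, if_neg (by omega), if_pos rfl,
        if_neg (by omega), if_neg (by omega), if_pos rfl]
      rw [Finset.sum_eq_zero, add_zero, add_assoc]
      intro j hj
      simp only [Finset.mem_erase] at hj
      rw [if_neg hj.2.2.1, if_neg hj.2.1, if_neg hj.1, map_zero, zero_mul]
    rw [hsum]
    simp only [Nat.cast_zero, mul_zero, zero_mul, map_zero, add_zero, Nat.zero_add,
      show B + 2 - i = 0 + 2 by omega, show B + 2 - (i + 1) = 0 + 1 by omega,
      show B + 2 - (i + 2) = 0 by omega, map_neg, map_mul, map_natCast]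
    ring
  · refine ⟨fun j => if j = i then -(a * ((2 * b + 3 : ℕ) : R)) else if j = i + 1 then
      -(a * (2 * ((b : R) + 1) * W.a₂)) else if j = i + 2 then -(a * ((2 * (b : R) + 1) * W.a₄))
      else if j = i + 3 then -(a * (2 * (b : R) * W.a₆)) else 0, ?_⟩
    have hsum : ∀ (f : ℕ → R⟦X⟧), ∑ j ∈ Finset.range (B + 3),
        C (if j = i then -(a * ((2 * b + 3 : ℕ) : R)) else if j = i + 1 then
          -(a * (2 * ((b : R) + 1) * W.a₂)) else if j = i + 2 then -(a * ((2 * (b : R) + 1) * W.a₄))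
          else if j = i + 3 then -(a * (2 * (b : R) * W.a₆)) else 0) * f j =
        C (-(a * ((2 * b + 3 : ℕ) : R))) * f i + C (-(a * (2 * ((b : R) + 1) * W.a₂))) * f (i + 1) +
          C (-(a * ((2 * (b : R) + 1) * W.a₄))) * f (i + 2) +
          C (-(a * (2 * (b : R) * W.a₆))) * f (i + 3) := by
      intro f
      have hi0 : i ∈ Finset.range (B + 3) := Finset.mem_range.mpr (by omega)
      have hi1 : i + 1 ∈ (Finset.range (B + 3)).erase i :=
        Finset.mem_erase.mpr ⟨by omega, Finset.mem_range.mpr (by omega)⟩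
      have hi2 : i + 2 ∈ ((Finset.range (B + 3)).erase i).erase (i + 1) :=
        Finset.mem_erase.mpr ⟨by omega, Finset.mem_erase.mpr ⟨by omega, Finset.mem_range.mpr (by omega)⟩⟩
      have hi3 : i + 3 ∈ (((Finset.range (B + 3)).erase i).erase (i + 1)).erase (i + 2) :=
        Finset.mem_erase.mpr ⟨by omega, Finset.mem_erase.mpr ⟨by omega,
          Finset.mem_erase.mpr ⟨by omega, Finset.mem_range.mpr (by omega)⟩⟩⟩
      rw [← Finset.add_sum_erase _ _ hi0, ← Finset.add_sum_erase _ _ hi1,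
        ← Finset.add_sum_erase _ _ hi2, ← Finset.add_sum_erase _ _ hi3, if_pos rfl, if_neg (by omega),
        if_pos rfl, if_neg (by omega), if_neg (by omega), if_pos rfl, if_neg (by omega),
        if_neg (by omega), if_neg (by omega), if_pos rfl]
      rw [Finset.sum_eq_zero, add_zero]
      · ring
      intro j hj
      simp only [Finset.mem_erase] at hj
      rw [if_neg hj.2.2.2.1, if_neg hj.2.2.1, if_neg hj.2.1, if_neg hj.1, map_zero, zero_mul]
    rw [hsum]
    simp only [show B + 2 - i = b + 2 by omega, show B + 2 - (i + 1) = b + 1 by omega,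
      show B + 2 - (i + 2) = b by omega, show B + 2 - (i + 3) = b - 1 by omega, map_neg, map_mul]
    ring

/-- Sums of such representations. [folklore] -/
theorem _root_.Literature.NumberTheory.EllipticCurves.exists_sum_eq_sum_C_mul_of_forall {ι : Type*} (s : Finset ι) (F : ι → R⟦X⟧) (N : ℕ)
    (E : ℕ → R⟦X⟧)
    (h : ∀ b ∈ s, ∃ r : ℕ → R, F b = ∑ j ∈ Finset.range N, C (r j) * E j) :
    ∃ r : ℕ → R, ∑ b ∈ s, F b = ∑ j ∈ Finset.range N, C (r j) * E j := by
  classical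
  induction s using Finset.induction_on with
  | empty => exact ⟨fun _ => 0, by simp⟩
  | insert b s hbs ih =>
    obtain ⟨r₁, hr₁⟩ := h b (Finset.mem_insert_self b s)
    obtain ⟨r₂, hr₂⟩ := ih fun b' hb' => h b' (Finset.mem_insert_of_mem hb')
    refine ⟨fun j => r₁ j + r₂ j, ?_⟩
    rw [Finset.sum_insert hbs, hr₁, hr₂, ← Finset.sum_add_distrib]
    refine Finset.sum_congr rfl fun j _ => ?_
    rw [map_add, add_mul]

/-- **The core congruence** (Prop. 3(c) + Lemma 4), over a ring `S` in which `K = 2B + 3`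
vanishes. Let `Z = Σ_b c_b z^{2(B-b)}X^{b+1}` (a cleared element of `L(K·O)`) have constant term
`1`, no terms in degrees `1, …, K - 2`, and residue relation `[z^{K-1}](Z·W) = 0`, and let
`w = w_{K-1} = [z^{K-1}]W` be a unit. Then there is `β ∈ S` with

  `(i - 1) · [z^{i+K-1}] Z = w · [zⁱ]((X - βz²)·W)`  for all `i`,

i.e. `z_K' = w·(x - β)·ω/dz` for `z_K = Z/z^K` ("`D(ζ_n) ≡ -x + β_n (mod pⁿ)`" for
`ζ_n = w⁻¹(z^{-K} - z_K)`, with `K = pⁿ`). [Blakestad–Grant 2023, Prop. 3(c), Lemma 4]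
[cite: BlakestadGrant2023, Prop. 3] -/
theorem padicWeierstrassZeta_core {B : ℕ} (hK : ((2 * B + 3 : ℕ) : R) = 0) {Z : R⟦X⟧}
    (hZ : ∃ c : ℕ → R, Z = ∑ b ∈ Finset.range (B + 1),
      C (c b) * (X ^ (2 * (B - b)) * W.formalXMulSq ^ (b + 1)))
    (h0 : constantCoeff Z = 1) (hgap : ∀ j, 1 ≤ j → j ≤ 2 * B + 1 → coeff j Z = 0)
    (hres : coeff (2 * B + 2) (Z * W.formalInvDiff) = 0)
    (hw : IsUnit (coeff (2 * B + 2) W.formalInvDiff)) :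
    ∃ β : R, ∀ i : ℕ, ((i : R) - 1) * coeff (i + (2 * B + 2)) Z =
      coeff (2 * B + 2) W.formalInvDiff * coeff i ((W.formalXMulSq - C β * X ^ 2) * W.formalInvDiff) := by
  set Xs := W.formalXMulSq with hXs
  set η := W.formalEta with hη
  set Wd := W.formalInvDiff with hWd
  set w := coeff (2 * B + 2) Wd with hw'
  obtain ⟨c, hc⟩ := hZ
  -- (1) `Λ := z·DZ - KηZ = z·η·Z'` since `K = 0`
  have hΛ : X * W.formalInvariantDerivation Z - C ((2 * B + 3 : ℕ) : R) * η * Z = X * η * d⁄dX R Z := by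
    rw [hK, map_zero, zero_mul, zero_mul, sub_zero, formalInvariantDerivation_apply, mul_assoc]
  -- (2) `Λ ∈ span{z^{2j} X^{B+2-j} : j ≤ B+2}`
  obtain ⟨r, hr⟩ : ∃ r : ℕ → R, X * W.formalInvariantDerivation Z - C ((2 * B + 3 : ℕ) : R) * η * Z =
      ∑ j ∈ Finset.range (B + 3), C (r j) * (X ^ (2 * j) * Xs ^ (B + 2 - j)) := by
    have hlin : X * W.formalInvariantDerivation Z - C ((2 * B + 3 : ℕ) : R) * η * Z =
        ∑ b ∈ Finset.range (B + 1), (X * W.formalInvariantDerivation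
            (C (c b) * (X ^ (2 * (B - b)) * Xs ^ (b + 1))) -
          C ((2 * B + 3 : ℕ) : R) * η * (C (c b) * (X ^ (2 * (B - b)) * Xs ^ (b + 1)))) := by
      rw [hc, map_sum, Finset.mul_sum, Finset.mul_sum, ← Finset.sum_sub_distrib]
    rw [hlin]
    exact exists_sum_eq_sum_C_mul_of_forall _ _ _ _ fun b hb =>
      W.exists_X_mul_D_sub_zMonomial_eq_sum (Nat.lt_succ_iff.mp (Finset.mem_range.mp hb)) (c b)
  -- (3) the coefficients of `Λ = zηZ'` vanish in degrees `≤ 2B+1`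
  have hlow : ∀ n ≤ 2 * B + 1, coeff n (X * η * d⁄dX R Z) = 0 := by
    intro n hn
    rcases n with _ | n
    · rw [mul_assoc, coeff_zero_X_mul]
    · rw [mul_assoc, coeff_succ_X_mul, coeff_mul]
      refine Finset.sum_eq_zero fun ⟨u, v⟩ huv => ?_
      have hv : v ≤ n := by
        have := Finset.mem_antidiagonal.mp huv; simp only at this; omega
      rw [coeff_derivative, hgap (v + 1) (by omega) (by omega), zero_mul, mul_zero]
  -- (4) unitriangularity: `r j = 0` for `j ≤ B`
  have hrj : ∀ j < B + 1, r j ∈ (⊥ : Ideal R) := by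
    refine mem_of_coeff_sum_mem ⊥ (fun j => Xs ^ (B + 2 - j)) (fun j => ?_) r (B + 2) (B + 1)
      (by omega) fun j hj => ?_
    · simp only [map_pow, hXs, constantCoeff_formalXMulSq, one_pow]
    · rw [← hr, hΛ, Ideal.mem_bot]
      exact hlow _ (by omega)
  simp only [Ideal.mem_bot] at hrj
  -- (5) hence `zηZ' = z^{2B+2}·(r₁ X + r₀ z²)`
  have hΛ' : X * η * d⁄dX R Z = X ^ (2 * B + 2) * (C (r (B + 1)) * Xs + C (r (B + 2)) * X ^ 2) := by
    rw [← hΛ, hr, Finset.sum_range_succ, Finset.sum_range_succ, Finset.sum_eq_zero, zero_add,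
      show B + 2 - (B + 1) = 1 by omega, Nat.sub_self, pow_one, pow_zero, mul_one]
    · ring
    · intro j hj
      rw [hrj j (Finset.mem_range.mp hj), map_zero, zero_mul]
  -- (6) multiply by `W`: `z Z' = z^{2B+2}(r₁X + r₀z²)W`
  have hZ' : X * d⁄dX R Z = X ^ (2 * B + 2) * ((C (r (B + 1)) * Xs + C (r (B + 2)) * X ^ 2) * Wd) := by
    have hηω : η * Wd = 1 := W.formalEta_mul_formalInvDiff
    linear_combination Wd * hΛ' - (X * d⁄dX R Z) * hηω
  -- (7) the coefficient of `z^{2B+2}`: `(K-1) Z_{K-1} = r₁`, i.e. `r₁ = -Z_{K-1}`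
  have hcast : ((2 * B + 1 : ℕ) : R) + 1 = -1 := by
    have : ((2 * B + 3 : ℕ) : R) = ((2 * B + 1 : ℕ) : R) + 1 + 1 := by push_cast; ring
    rw [this] at hK; linear_combination hK
  have hr1 : r (B + 1) = -coeff (2 * B + 2) Z := by
    have h := congrArg (coeff (2 * B + 2)) hZ'
    rw [show 2 * B + 2 = (2 * B + 1) + 1 from rfl, coeff_succ_X_mul, coeff_derivative,
      coeff_X_pow_mul_of_le le_rfl, Nat.sub_self, coeff_zero_eq_constantCoeff] at h
    simp only [map_mul, map_add, constantCoeff_C, hXs, constantCoeff_formalXMulSq, map_pow,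
      constantCoeff_X, hWd, constantCoeff_formalInvDiff, hcast] at h
    linear_combination -h
  -- (8) the residue: `Z_{K-1} = -w`
  have hZK : coeff (2 * B + 2) Z = -w := by
    have hsum : coeff (2 * B + 2) (Z * Wd) =
        ∑ k ∈ Finset.range (2 * B + 2).succ, coeff k Z * coeff (2 * B + 2 - k) Wd := by
      rw [coeff_mul]
      exact Finset.Nat.sum_antidiagonal_eq_sum_range_succ (fun k l => coeff k Z * coeff l Wd) _
    rw [hsum, Finset.sum_range_succ, Finset.sum_range_succ', Finset.sum_eq_zero, zero_add,
      Nat.sub_self, Nat.sub_zero, coeff_zero_eq_constantCoeff, h0,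
      hWd, constantCoeff_formalInvDiff, one_mul, mul_one] at hres
    · rw [hw', hWd]
      linear_combination hres
    · intro k hk
      rw [hgap (k + 1) (by omega) (by have := Finset.mem_range.mp hk; omega), zero_mul]
  -- (9) put `β := -r₀ w⁻¹`
  obtain ⟨u, hu⟩ := hw.exists_right_inv
  refine ⟨-(r (B + 2) * u), fun i => ?_⟩
  have hfac : (C (r (B + 1)) * Xs + C (r (B + 2)) * X ^ 2) * Wd =
      C w * ((Xs - C (-(r (B + 2) * u)) * X ^ 2) * Wd) := by
    rw [hr1, hZK, neg_neg, map_neg, map_mul]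
    have hu' : (C w : R⟦X⟧) * C u = 1 := by rw [← map_mul, hu, map_one]
    linear_combination (-(C (r (B + 2)) : R⟦X⟧) * X ^ 2 * Wd) * hu'
  have h := congrArg (coeff (i + (2 * B + 2))) hZ'
  rw [hfac, show i + (2 * B + 2) = (i + (2 * B + 1)) + 1 by ring, coeff_succ_X_mul, coeff_derivative,
    show i + (2 * B + 1) + 1 = (2 * B + 2) + i by ring, coeff_X_pow_mul_of_le (by omega),
    Nat.add_sub_cancel_left, coeff_C_mul] at h
  rw [show (2 * B + 2) + i = i + (2 * B + 2) by ring] at h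
  rw [← h]
  push_cast at hcast ⊢
  linear_combination (-(coeff (i + (2 * B + 2)) Z : R)) * hcast

end Core

/-! ### Level `K`: the differential `(w_{K-1}x - r)ω` is exact modulo `K` -/

section Level

variable [W.IsCharNeTwoNF] [IsAddTorsionFree R]

/-- **Prop. 3(c) over `R` (level `K = 2B + 3`).** If `w_{K-1}` is a unit there is `β_K ∈ R`
(`= J/H` in Blakestad–Grant's notation) such that for every `k` the coefficient of `z^{k+1}` in
`(X - β_K z²)·W` — i.e. of `z^{k-1}dz` in `(x - β_K)ω` — lies in `kR + KR`: the differential of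
the second kind `(x - β_K)ω` is formally exact modulo `K`. [Blakestad–Grant 2023, Prop. 3(c)
("`Dζ_n ≡ -x + β_n (mod pⁿ)`") with Lemma 4] [cite: BlakestadGrant2023, Prop. 3] -/
theorem padicWeierstrassZeta_level (B : ℕ) (hw : IsUnit (coeff (2 * B + 2) W.formalInvDiff)) :
    ∃ β : R, ∀ k : ℕ, coeff (k + 1) ((W.formalXMulSq - C β * X ^ 2) * W.formalInvDiff) ∈
      Ideal.span {(k : R)} ⊔ Ideal.span {((2 * B + 3 : ℕ) : R)} := by
  classical
  set I : Ideal R := Ideal.span {((2 * B + 3 : ℕ) : R)} with hI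
  set π : R →+* R ⧸ I := Ideal.Quotient.mk I with hπ
  obtain ⟨Z, ⟨c, hc⟩, h0, hgap, hres⟩ := W.exists_zFun B
  -- base change to `S = R ⧸ (K)`
  set W' : WeierstrassCurve (R ⧸ I) := W.map π with hW'
  haveI : W'.IsCharNeTwoNF :=
    ⟨by rw [hW', map_a₁, W.a₁_of_isCharNeTwoNF, map_zero],
     by rw [hW', map_a₃, W.a₃_of_isCharNeTwoNF, map_zero]⟩
  have hK' : ((2 * B + 3 : ℕ) : R ⧸ I) = 0 := by
    rw [← map_natCast π, hπ, Ideal.Quotient.eq_zero_iff_mem]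
    exact Ideal.mem_span_singleton_self _
  have hXs' : W'.formalXMulSq = PowerSeries.map π W.formalXMulSq := (W.map_formalXMulSq π).symm
  have hWd' : W'.formalInvDiff = PowerSeries.map π W.formalInvDiff := (W.map_formalInvDiff π).symm
  set Z' := PowerSeries.map π Z with hZ'def
  have hZ' : ∃ c' : ℕ → R ⧸ I, Z' = ∑ b ∈ Finset.range (B + 1),
      C (c' b) * (X ^ (2 * (B - b)) * W'.formalXMulSq ^ (b + 1)) := by
    refine ⟨fun b => π (c b), ?_⟩
    rw [hZ'def, hc, map_sum]
    refine Finset.sum_congr rfl fun b _ => ?_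
    rw [map_mul, map_C, map_mul, map_pow, map_pow, map_X, hXs']
  have h0' : constantCoeff Z' = 1 := by
    rw [hZ'def, ← coeff_zero_eq_constantCoeff_apply, coeff_map, coeff_zero_eq_constantCoeff_apply, h0,
      map_one]
  have hgap' : ∀ j, 1 ≤ j → j ≤ 2 * B + 1 → coeff j Z' = 0 := fun j hj1 hj2 => by
    rw [hZ'def, coeff_map, hgap j hj1 hj2, map_zero]
  have hres' : coeff (2 * B + 2) (Z' * W'.formalInvDiff) = 0 := by
    rw [hWd', hZ'def, ← map_mul, coeff_map, hres, map_zero]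
  have hw' : IsUnit (coeff (2 * B + 2) W'.formalInvDiff) := by
    rw [hWd', coeff_map]; exact hw.map π
  obtain ⟨β', hβ'⟩ := W'.padicWeierstrassZeta_core hK' hZ' h0' hgap' hres' hw'
  obtain ⟨β, rfl⟩ := Ideal.Quotient.mk_surjective β'
  obtain ⟨u, hu⟩ := hw.exists_left_inv
  refine ⟨β, fun k => ?_⟩
  have h := hβ' (k + 1)
  have hΦ : (W'.formalXMulSq - C (Ideal.Quotient.mk I β) * X ^ 2) * W'.formalInvDiff =
      PowerSeries.map π ((W.formalXMulSq - C β * X ^ 2) * W.formalInvDiff) := by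
    rw [hXs', hWd', map_mul, map_sub, map_mul, map_pow, map_C, map_X]
  rw [hΦ, coeff_map, hWd', coeff_map, coeff_map, Nat.cast_add, Nat.cast_one,
    add_sub_cancel_right, ← map_natCast π, ← map_mul, ← map_mul, hπ, Ideal.Quotient.eq] at h
  set cZ := coeff (k + 1 + (2 * B + 2)) Z
  set cΦ := coeff (k + 1) ((W.formalXMulSq - C β * X ^ 2) * W.formalInvDiff)
  have hexpr : cΦ = (u * cZ) * k - u * ((k : R) * cZ - coeff (2 * B + 2) W.formalInvDiff * cΦ) := by
    linear_combination (-cΦ) * hu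
  rw [hexpr]
  refine Submodule.sub_mem _ (Ideal.mem_sup_left (Ideal.mem_span_singleton'.mpr ⟨u * cZ, rfl⟩))
    (Ideal.mem_sup_right (I.mul_mem_left u h))

end Level

/-! ### Theorem 2: the `p`-adic limit -/

section Limit

variable (p : ℕ) [Fact p.Prime]

omit W in
/-- `x ≡ y [SMOD J • ⊤]` in `R` means `x - y ∈ J`. [folklore] -/
theorem _root_.Literature.NumberTheory.EllipticCurves.smodEq_smul_top_iff_sub_mem (J : Ideal R)
    (x y : R) : x ≡ y [SMOD (J • ⊤ : Submodule R R)] ↔ x - y ∈ J := by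
  rw [SModEq.sub_mem, Ideal.smul_eq_mul, Ideal.mul_top]

/-- An odd prime power is `2B + 3`. [folklore] -/
theorem _root_.Literature.NumberTheory.EllipticCurves.two_mul_div_add_three_eq_prime_pow
    (hp2 : p ≠ 2) (n : ℕ) : 2 * ((p ^ (n + 1) - 3) / 2) + 3 = p ^ (n + 1) := by
  have hp : p.Prime := Fact.out
  have hodd : Odd (p ^ (n + 1)) := (hp.odd_of_ne_two hp2).pow
  have h3 : 3 ≤ p ^ (n + 1) := by
    have h2 : 2 ≤ p := hp.two_le
    have : 3 ≤ p := by omega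
    calc 3 ≤ p := this
      _ = p ^ 1 := (pow_one p).symm
      _ ≤ p ^ (n + 1) := Nat.pow_le_pow_right hp.pos (by omega)
  obtain ⟨k, hk⟩ := hodd
  omega

/-- Changing `β` changes `[z^{k+1}]((X - βz²)W)` by `(β' - β)·w_{k-1}`-type terms:
`(X - βz²)W - (X - β'z²)W = (β' - β) z² W`. [folklore] -/
theorem padicWeierstrassZeta_coeff_sub (β β' : R) (k : ℕ) :
    coeff (k + 2) ((W.formalXMulSq - C β * X ^ 2) * W.formalInvDiff) -
        coeff (k + 2) ((W.formalXMulSq - C β' * X ^ 2) * W.formalInvDiff) =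
      (β' - β) * coeff k W.formalInvDiff := by
  rw [← map_sub, show (W.formalXMulSq - C β * X ^ 2) * W.formalInvDiff -
      (W.formalXMulSq - C β' * X ^ 2) * W.formalInvDiff = C (β' - β) * (X ^ 2 * W.formalInvDiff) by
        rw [map_sub]; ring, coeff_C_mul, coeff_X_pow_mul_of_le (by omega), Nat.add_sub_cancel]

variable [W.IsCharNeTwoNF]
variable [IsAddTorsionFree R] [IsAdicComplete (Ideal.span {(p : R)}) R]

/-- **Theorem 2 (Blakestad–Grant): the canonical constant `β`.** Over a `p`-adically complete,
additively torsion-free ring (`p` odd), for a model with `a₁ = a₃ = 0` all of whose Hasse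
coefficients `w_{pⁿ-1}` are units, there is `β ∈ R` such that the differential of the second
kind `(x - β)ω` is formally exact: `k ∣ [z^{k+1}]((X - βz²)·W)` (`= [z^{k-1}]((x - β)ω/dz)`) for
every `k`. (`β = lim β_n`, `β_{n+1} ≡ β_n (mod pⁿ)` by Lemma 4; "for every `n ≥ 1`, the
coefficient of `t^{pn-1}` in the expansion of `(-x(t)+β)ω/dt` vanishes mod `pn`".)
[Blakestad–Grant 2023, Thm. 2 (proof)] [cite: BlakestadGrant2023, Thm. 2] -/
theorem exists_padicWeierstrassZetaConst (hp2 : p ≠ 2)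
    (hw : ∀ n : ℕ, IsUnit (coeff (p ^ (n + 1) - 1) W.formalInvDiff)) :
    ∃ β : R, ∀ k : ℕ, (k : R) ∣ coeff (k + 1) ((W.formalXMulSq - C β * X ^ 2) * W.formalInvDiff) := by
  have hp : p.Prime := Fact.out
  -- notation
  set Φ : R → R⟦X⟧ := fun β => (W.formalXMulSq - C β * X ^ 2) * W.formalInvDiff with hΦ
  have hΦsub : ∀ (β β' : R) (k : ℕ),
      coeff (k + 1 + 1) (Φ β) - coeff (k + 1 + 1) (Φ β') = (β' - β) * coeff k W.formalInvDiff :=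
    fun β β' k => W.padicWeierstrassZeta_coeff_sub β β' k
  have hle : ∀ {a b : ℕ}, a ≤ b → Ideal.span {(p : R) ^ b} ≤ Ideal.span {(p : R) ^ a} :=
    fun hab => by rw [Ideal.span_singleton_le_span_singleton]; exact pow_dvd_pow _ hab
  have hk2 : ∀ n, p ^ (n + 1) - 1 + 1 + 1 = p ^ (n + 1) + 1 := fun n => by
    have := Nat.one_le_pow (n + 1) p hp.pos; omega
  -- level `p^{n+1}` for every `n`
  have hlevel : ∀ n : ℕ, ∃ β : R, ∀ k : ℕ, coeff (k + 1) (Φ β) ∈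
      Ideal.span {(k : R)} ⊔ Ideal.span {(p : R) ^ (n + 1)} := by
    intro n
    have hB := two_mul_div_add_three_eq_prime_pow p hp2 n
    have hwB : IsUnit (coeff (2 * ((p ^ (n + 1) - 3) / 2) + 2) W.formalInvDiff) := by
      rw [show 2 * ((p ^ (n + 1) - 3) / 2) + 2 = p ^ (n + 1) - 1 by omega]; exact hw n
    have hcast : ((2 * ((p ^ (n + 1) - 3) / 2) + 3 : ℕ) : R) = (p : R) ^ (n + 1) := by
      rw [hB, Nat.cast_pow]
    rw [← hcast]
    exact W.padicWeierstrassZeta_level _ hwB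
  choose β hβ using hlevel
  -- `β (n+1) ≡ β n (mod p^{n+1})` (Lemma 4: compare the coefficients of `z^{p^{n+1}+1}`)
  have hstep : ∀ n, β (n + 1) - β n ∈ Ideal.span {(p : R) ^ (n + 1)} := by
    intro n
    have h1 : coeff (p ^ (n + 1) + 1) (Φ (β n)) ∈ Ideal.span {(p : R) ^ (n + 1)} := by
      have h := hβ n (p ^ (n + 1))
      rw [Nat.cast_pow, sup_idem] at h
      exact h
    have h2 : coeff (p ^ (n + 1) + 1) (Φ (β (n + 1))) ∈ Ideal.span {(p : R) ^ (n + 1)} := by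
      have h := hβ (n + 1) (p ^ (n + 1))
      rw [Nat.cast_pow] at h
      exact (sup_le le_rfl (hle (Nat.le_succ _))) h
    have hdiff := hΦsub (β n) (β (n + 1)) (p ^ (n + 1) - 1)
    rw [hk2] at hdiff
    obtain ⟨u, hu⟩ := (hw n).exists_right_inv
    have hmem : (β (n + 1) - β n) * coeff (p ^ (n + 1) - 1) W.formalInvDiff ∈
        Ideal.span {(p : R) ^ (n + 1)} := by
      rw [← hdiff]; exact Ideal.sub_mem _ h1 h2
    have := Ideal.mul_mem_right u _ hmem
    rwa [mul_assoc, hu, mul_one] at this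
  -- hence `β m ≡ β n (mod p^{n+1})` for `m ≥ n`
  have hchain : ∀ n m, n ≤ m → β m - β n ∈ Ideal.span {(p : R) ^ (n + 1)} := by
    intro n m hnm
    induction m, hnm using Nat.le_induction with
    | base => rw [sub_self]; exact Ideal.zero_mem _
    | succ m hnm ih =>
      have := Ideal.add_mem _ (hle (by omega : n + 1 ≤ m + 1) (hstep m)) ih
      rwa [sub_add_sub_cancel] at this
  -- the limit `L = lim β n`
  obtain ⟨L, hL⟩ : ∃ L : R, ∀ n, β n - L ∈ Ideal.span {(p : R) ^ n} := by
    obtain ⟨L, hL⟩ := IsPrecomplete.prec' (I := Ideal.span {(p : R)}) (M := R) β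
      (fun {m n} hmn => by
        rw [Ideal.span_singleton_pow, smodEq_smul_top_iff_sub_mem]
        have h := (Ideal.span {(p : R) ^ (m + 1)}).neg_mem (hchain m n hmn)
        rw [neg_sub] at h
        exact hle (Nat.le_succ m) h)
    refine ⟨L, fun n => ?_⟩
    have h := hL n
    rwa [Ideal.span_singleton_pow, smodEq_smul_top_iff_sub_mem] at h
  refine ⟨L, fun k => ?_⟩
  rcases Nat.eq_zero_or_pos k with rfl | hkpos
  · -- `k = 0`: the coefficient of `z` vanishes by parity
    rw [Nat.cast_zero, zero_dvd_iff, zero_add]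
    refine coeff_eq_zero_of_rescale_neg_one_eq_self ?_ odd_one
    have hX2 : rescale (-1 : R) ((X : R⟦X⟧) ^ 2) = X ^ 2 := by
      have h := rescale_neg_one_X_pow_two_mul (R := R) 1
      rwa [mul_one] at h
    show rescale (-1 : R) ((W.formalXMulSq - C L * X ^ 2) * W.formalInvDiff) =
      (W.formalXMulSq - C L * X ^ 2) * W.formalInvDiff
    rw [map_mul, map_sub, map_mul, rescale_C_eq, hX2, W.rescale_neg_one_formalXMulSq,
      W.rescale_neg_one_formalInvDiff]
  · obtain ⟨k₀, rfl⟩ : ∃ k₀, k = k₀ + 1 := ⟨k - 1, by omega⟩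
    obtain ⟨j, k', hk', hk⟩ :=
      Nat.exists_eq_pow_mul_and_not_dvd (show k₀ + 1 ≠ 0 by omega) p hp.one_lt.ne'
    have hunit : IsUnit ((k' : ℕ) : R) :=
      isUnit_natCast_of_coprime (p := p) ((hp.coprime_iff_not_dvd.mpr hk').symm)
    have hspan : Ideal.span {((k₀ + 1 : ℕ) : R)} = Ideal.span {(p : R) ^ j} := by
      rw [hk, Nat.cast_mul, Nat.cast_pow, Ideal.span_singleton_mul_right_unit hunit]
    rw [← Ideal.mem_span_singleton, hspan]
    -- compare with `β j` at level `p^{j+1}`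
    have h1 : coeff (k₀ + 1 + 1) (Φ (β j)) ∈ Ideal.span {(p : R) ^ j} := by
      have h := hβ j (k₀ + 1)
      rw [hspan] at h
      exact (sup_le le_rfl (hle (Nat.le_succ _))) h
    have hdiff := hΦsub L (β j) k₀
    have h2 : (β j - L) * coeff k₀ W.formalInvDiff ∈ Ideal.span {(p : R) ^ j} :=
      Ideal.mul_mem_right _ _ (hL j)
    have := Ideal.add_mem _ h1 h2
    rwa [← hdiff, add_sub_cancel] at this

omit [W.IsCharNeTwoNF] [IsAddTorsionFree R] in
/-- **Uniqueness of `β`** (`R` `p`-adically separated): two constants for which `(x - β)ω` is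
formally exact agree — compare the coefficients of `z^{pⁿ+1}` ("`β_{n+1} ≡ β_n mod pⁿ`",
Lemma 4, and pass to the limit). [Blakestad–Grant 2023, Thm. 2 ("there is a unique Laurent
series …"), Lemma 4] [cite: BlakestadGrant2023, Thm. 2] -/
theorem padicWeierstrassZetaConst_unique (hw : ∀ n : ℕ, IsUnit (coeff (p ^ (n + 1) - 1) W.formalInvDiff))
    {β β' : R}
    (h : ∀ k : ℕ, (k : R) ∣ coeff (k + 1) ((W.formalXMulSq - C β * X ^ 2) * W.formalInvDiff))
    (h' : ∀ k : ℕ, (k : R) ∣ coeff (k + 1) ((W.formalXMulSq - C β' * X ^ 2) * W.formalInvDiff)) :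
    β = β' := by
  have hp : p.Prime := Fact.out
  rw [← sub_eq_zero]
  refine IsHausdorff.haus' (I := Ideal.span {(p : R)}) (β - β') fun n => ?_
  rw [Ideal.span_singleton_pow, smodEq_smul_top_iff_sub_mem, sub_zero]
  have hle : Ideal.span {(p : R) ^ (n + 1)} ≤ Ideal.span {(p : R) ^ n} := by
    rw [Ideal.span_singleton_le_span_singleton]
    exact pow_dvd_pow _ (Nat.le_succ _)
  refine hle ?_
  have hk2 : p ^ (n + 1) - 1 + 2 = p ^ (n + 1) + 1 := by
    have := Nat.one_le_pow (n + 1) p hp.pos; omega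
  have hdiff := W.padicWeierstrassZeta_coeff_sub β' β (p ^ (n + 1) - 1)
  rw [hk2] at hdiff
  have hmem : (β - β') * coeff (p ^ (n + 1) - 1) W.formalInvDiff ∈ Ideal.span {(p : R) ^ (n + 1)} := by
    rw [← hdiff, ← Nat.cast_pow]
    exact Ideal.sub_mem _ (Ideal.mem_span_singleton.mpr (h' _)) (Ideal.mem_span_singleton.mpr (h _))
  obtain ⟨u, hu⟩ := (hw n).exists_right_inv
  have := Ideal.mul_mem_right u _ hmem
  rwa [mul_assoc, hu, mul_one] at this

omit [W.IsCharNeTwoNF] [IsAddTorsionFree R] in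
/-- **Ordinary ⇒ all Hasse coefficients `w_{pⁿ-1}` are units.** In a `p`-adically complete ring
(`p` odd) it suffices that `w_{p-1}` (`≡` the Hasse invariant `A_p` modulo `p`,
`coeff_formalInvDiff_prime_sub_one`) be a unit: `w_{p^k-1} ≡ A_p^{1+p+⋯+p^{k-1}} (mod p)`.
[Blakestad–Grant 2023, Prop. 3(b) ("`H_n ≡ H_1^{1+p+⋯+p^{n-1}} mod p`, so `H_n` is invertible in
`R̂`") and Lemma 4 (`w_{pⁿ-1} = H_n`)] [cite: BlakestadGrant2023, Prop. 3] -/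
theorem isUnit_coeff_formalInvDiff_prime_pow_sub_one (hp2 : p ≠ 2)
    (hA : IsUnit (coeff (p - 1) W.formalInvDiff)) (n : ℕ) :
    IsUnit (coeff (p ^ (n + 1) - 1) W.formalInvDiff) := by
  have hp : p.Prime := Fact.out
  rcases subsingleton_or_nontrivial R with hR | hR
  · exact isUnit_of_subsingleton _
  obtain ⟨m, hpm⟩ : ∃ m, p = 2 * m + 1 := hp.eq_two_or_odd'.resolve_left hp2
  set I : Ideal R := Ideal.span {(p : R)} with hI
  have hJ : I ≤ (⊥ : Ideal R).jacobson := IsAdicComplete.le_jacobson_bot _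
  -- `p` is not a unit (else `R = 0` by separatedness)
  have hpu : (p : R) ∈ nonunits R := by
    intro hunit
    have h1 : (1 : R) = 0 := by
      refine IsHausdorff.haus' (I := I) 1 fun k => ?_
      rw [smodEq_smul_top_iff_sub_mem, sub_zero, hI, Ideal.span_singleton_eq_top.mpr hunit,
        Ideal.top_pow]
      exact Submodule.mem_top
    exact one_ne_zero h1
  haveI : CharP (R ⧸ I) p := CharP.quotient R p hpu
  set π : R →+* R ⧸ I := Ideal.Quotient.mk I
  set W' : WeierstrassCurve (R ⧸ I) := W.map π with hW'
  have hcoe : ∀ k, coeff k W'.formalInvDiff = π (coeff k W.formalInvDiff) := fun k => by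
    rw [hW', ← W.map_formalInvDiff π, coeff_map]
  refine isUnit_of_isUnit_quotient_mk hJ ?_
  rw [← hcoe, W'.coeff_formalInvDiff_prime_pow_sub_one p hpm (n + 1),
    ← W'.coeff_formalInvDiff_prime_sub_one p hpm, hcoe]
  exact (hA.map π).pow _

end Limit

/-! ### The zeta series `ζ = Λ/z`, `Dζ = -x + β` -/

section Zeta

/-- **The `p`-adic Weierstrass zeta function as a series.** If `(x - β)ω` is formally exact
(`k ∣ [z^{k+1}]((X - βz²)W)` for all `k`), there is `Λ = 1 + ⋯ ∈ R⟦z⟧` with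
`zΛ' - Λ = -(X - βz²)W`, i.e. `η·(zΛ' - Λ) = -(X - βz²)`: for the Laurent series
`ζ := Λ/z ∈ 1/z + R⟦z⟧` this is `Dζ = η·(zΛ' - Λ)/z² = -x + β`. (Over a torsion-free ring the
coefficients `[z^{k+1}]Λ`, `k ≥ 2`, are forced, and `ζ` can be taken odd since `(X - βz²)W` is
even; `[z¹]Λ` is free — Blakestad–Grant normalise by oddness.) [Blakestad–Grant 2023, Thm. 2
("Therefore there is a Laurent series `ζ(t) ∈ 1/t + R̂⟦t⟧` with the property that
`D(ζ(t)) = -x(t) + β`")] [cite: BlakestadGrant2023, Thm. 2] -/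
theorem exists_padicWeierstrassZetaSeries {β : R}
    (h : ∀ k : ℕ, (k : R) ∣ coeff (k + 1) ((W.formalXMulSq - C β * X ^ 2) * W.formalInvDiff)) :
    ∃ Λ : R⟦X⟧, constantCoeff Λ = 1 ∧
      X * d⁄dX R Λ - Λ = -((W.formalXMulSq - C β * X ^ 2) * W.formalInvDiff) ∧
      W.formalEta * (X * d⁄dX R Λ - Λ) = -(W.formalXMulSq - C β * X ^ 2) := by
  choose ℓ hℓ using h
  set Λ : R⟦X⟧ := PowerSeries.mk fun m => if m = 0 then 1 else -ℓ (m - 1) with hΛ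
  have h0 : constantCoeff Λ = 1 := by
    rw [← coeff_zero_eq_constantCoeff_apply, hΛ, coeff_mk, if_pos rfl]
  have hmain : X * d⁄dX R Λ - Λ = -((W.formalXMulSq - C β * X ^ 2) * W.formalInvDiff) := by
    ext m
    rw [map_sub, map_neg]
    rcases m with _ | k
    · rw [coeff_zero_X_mul, zero_sub, coeff_zero_eq_constantCoeff_apply, h0,
        coeff_zero_eq_constantCoeff_apply]
      simp [constantCoeff_formalXMulSq, constantCoeff_formalInvDiff]
    · rw [coeff_succ_X_mul, coeff_derivative, hℓ k, hΛ, coeff_mk, if_neg (Nat.succ_ne_zero k),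
        Nat.succ_sub_one]
      ring
  refine ⟨Λ, h0, hmain, ?_⟩
  rw [hmain, mul_neg, ← mul_assoc, mul_comm W.formalEta, mul_assoc, W.formalEta_mul_formalInvDiff,
    mul_one]

end Zeta

/-! ### Over `ℤ_p` -/

section PadicInt

variable (p : ℕ) [Fact p.Prime]

/-- `ℤ_p` is `(p)`-adically complete (Mathlib: w.r.t. the maximal ideal, which is `(p)`).
[folklore] -/
theorem _root_.Literature.NumberTheory.EllipticCurves.padicInt_isAdicComplete_span_p :
    IsAdicComplete (Ideal.span {(p : ℤ_[p])}) ℤ_[p] := by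
  rw [← PadicInt.maximalIdeal_eq_span_p]; infer_instance

/-- **The `p`-adic Weierstrass zeta function of an ordinary model over `ℤ_p`** (`p ≥ 3`,
`a₁ = a₃ = 0`, unit Hasse coefficient `w_{p-1}`): there is a UNIQUE `β ∈ ℤ_p` for which
`(x - β)ω` is formally exact, and then an (odd) Laurent series `ζ = Λ/z ∈ 1/z + ℤ_p⟦z⟧`,
`Λ = 1 + ⋯`, with `Dζ = -x + β` (`η(zΛ' - Λ) = -(X - βz²)`). This is Blakestad–Grant's Thm. 2
specialised along `R̂ → ℤ_p` (their Thm. 15 setting), the first step of the construction of the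
Mazur–Tate sigma function of a single ordinary curve (`ζ = Dσ/σ`, `β = -c` in
`x + c = -D(Dσ/σ)`, Mazur–Stein–Tate 2006 Thm. 1.3). [Blakestad–Grant 2023, Thm. 2, Thm. 15;
Mazur–Stein–Tate 2006, Thm. 1.3] [cite: BlakestadGrant2023, Thm. 2] -/
theorem padicInt_exists_padicWeierstrassZeta (hp2 : p ≠ 2) (W : WeierstrassCurve ℤ_[p]) [W.IsCharNeTwoNF]
    (hA : IsUnit (coeff (p - 1) W.formalInvDiff)) :
    (∃! β : ℤ_[p], ∀ k : ℕ, (k : ℤ_[p]) ∣ coeff (k + 1) ((W.formalXMulSq - C β * X ^ 2) * W.formalInvDiff)) ∧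
    ∃ β : ℤ_[p], ∃ Λ : ℤ_[p]⟦X⟧,
      (∀ k : ℕ, (k : ℤ_[p]) ∣ coeff (k + 1) ((W.formalXMulSq - C β * X ^ 2) * W.formalInvDiff)) ∧
      constantCoeff Λ = 1 ∧ W.formalEta * (X * d⁄dX ℤ_[p] Λ - Λ) = -(W.formalXMulSq - C β * X ^ 2) := by
  haveI := padicInt_isAdicComplete_span_p p
  have hw := W.isUnit_coeff_formalInvDiff_prime_pow_sub_one p hp2 hA
  obtain ⟨β, hβ⟩ := W.exists_padicWeierstrassZetaConst p hp2 hw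
  refine ⟨⟨β, hβ, fun β' hβ' => W.padicWeierstrassZetaConst_unique p hw hβ' hβ⟩, β, ?_⟩
  obtain ⟨Λ, h0, -, hΛ⟩ := W.exists_padicWeierstrassZetaSeries hβ
  exact ⟨Λ, hβ, h0, hΛ⟩

end PadicInt

end WeierstrassCurve
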